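import Summits.CriticalPhenomena.Ising3DConformalLimit.Theses.PerfectScreening
import Summits.CriticalPhenomena.Ising3DConformalLimit.Theses.HyperoctahedralRP
import Summits.CriticalPhenomena.Ising3DConformalLimit.Theses.PositivityBegetsConformality
import Summits.CriticalPhenomena.Ising3DConformalLimit.Theorems.PerfectScreeningMoebiusLimitExistsMackConverse
import Summits.CriticalPhenomena.Ising3DConformalLimit.Theorems.PerfectScreeningMoebiusLimitExistsTwoLeaf
import Summits.CriticalPhenomena.Ising3DConformalLimit.Theorems.HyperoctahedralRPInversionUpgradeNormalisedOSReflectionPositive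
import Summits.CriticalPhenomena.Ising3DConformalLimit.Theorems.HyperoctahedralRPInversionUpgradeNormalisedLatticeRP
import Summits.CriticalPhenomena.Ising3DConformalLimit.Theorems.HyperoctahedralRPInversionUpgradeNormalisedOSLayer
import Summits.CriticalPhenomena.Ising3DConformalLimit.Theorems.PositivityBegetsConformalityMoebiusOfInversionPositive
import HarnessLib

/-!
# `InversionPositiveLimit` (stmt-4671) ⟺ `InversionUpgradeNormalised` (stmt-1982), and
# `MoebiusLimitExists` (stmt-1344) ⟺ `ExistsScaleCovariantLimit` (stmt-1981) ∧ `InversionPositiveLimit`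

Route `PerfectScreening`, sub-problem `Ising3DConformalLimit`, line `Sketch` of crux
`MoebiusLimitExists` (lead `prover-line-stmt-CriticalPhenomena-1344-c12-0`).  Consequences of the
pointwise Mack converse `isInversionPositive_of_covariant_of_reflectionPositive`
(`PerfectScreeningMoebiusLimitExistsMackConverse.lean`: Möbius covariance + OS positivity along one
axis ⇒ inversion positivity) for the critical `ℤ³` Ising limit.  With the landed theorems — O(3)
invariance of every normalised non-degenerate translation-invariant scale-covariant pointwise limit
of `criticalCorr 3` (`isRotationInvariant_of_scaleCovariantLimit`, items 1979/1980), its reflection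
positivity along the axes (`stub_osReflectionPositive ∘ stub_latticeRP`, item 1982's line) and its
permutation symmetry (`isPermutationSymmetric_of_limit`):

* `isInversionPositive_of_limit` — an inversion-COVARIANT such limit is inversion POSITIVE;
* `inversionPositiveLimit_of_inversionUpgradeNormalised` — item stmt-1982 ⇒ item stmt-4671;
* `inversionUpgradeNormalised_of_inversionPositiveLimit` — item stmt-4671 ⇒ item stmt-1982 (item
  stmt-4673 `moebiusOfInversionPositive_proof`, already in tree, assembled);
* **`inversionPositiveLimit_iff_inversionUpgradeNormalised` — crux stmt-4671 ⟺ crux stmt-1982**: the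
  positivity crux of route `PositivityBegetsConformality` carries no content beyond Polyakov's
  inversion upgrade (its "inequality half" is implied by its "equality half"); the registered
  skeleton `Cruxes/InversionPositiveLimit/Lines/birth.lean` needs only its STUB 1;
* `inversionPositiveLimit_of_MoebiusLimitExists` — crux stmt-1344 ⇒ item stmt-4671;
* **`MoebiusLimitExists_iff_existence_and_inversionPositiveLimit`** (registered anchor) — crux
  stmt-1344 ⟺ item stmt-1981 ∧ item stmt-4671.

No `sorry`, no definitions.
-/

noncomputable section

open Filter Topology
open Literature.Probability.LatticeModels Literature.MathematicalPhysics.QuantumFieldTheory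

namespace Summit.CriticalPhenomena.Ising3DConformalLimit.MoebiusLimitExistsInversionPositive

open Summit.CriticalPhenomena.Ising3DConformalLimit.MoebiusLimitExistsMackConverse
  (isInversionPositive_of_covariant_of_reflectionPositive)
open Summit.CriticalPhenomena.Ising3DConformalLimit.Cruxes.InversionUpgradeNormalised.FreeEndpointGaussianClosure
  (stub_osReflectionPositive stub_latticeRP isPermutationSymmetric_of_limit)
open Summit.CriticalPhenomena.Ising3DConformalLimit.MoebiusLimitExistsTwoLeaf
  (isRotationInvariant_of_scaleCovariantLimit MoebiusLimitExists_of_leaves MoebiusLimitExists_iff_leaves)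
open Summit.CriticalPhenomena.Ising3DConformalLimit.PositivityBegetsConformalityMoebiusOfInversionPositive
  (moebiusOfInversionPositive_proof)

/-- **Inversion positivity of inversion-covariant Ising₃ limits.**  Every normalised,
non-degenerate, translation-invariant, scale-covariant pointwise scaling limit `S` of
`criticalCorr 3` which is inversion covariant with weight `Δ` is inversion POSITIVE with weight `Δ`:
O(3) invariance (`isRotationInvariant_of_scaleCovariantLimit`, items 1979/1980), reflection
positivity along the axes (`stub_osReflectionPositive ∘ stub_latticeRP`) and permutation symmetry
(`isPermutationSymmetric_of_limit`) are theorems for such limits, and Part 1 applies.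
[cite: LuscherMack1975, §2–§3] -/
theorem isInversionPositive_of_limit {ρ : ℝ → ℝ} {Δ : ℝ} {S : CorrFamily 3}
    (hρ : ∀ δ ∈ Set.Ioc (0:ℝ) 1, 0 < ρ δ) (hlim : HasPointwiseScalingLimit (criticalCorr 3) ρ S)
    (hnorm : ∀ n z, z ∉ NonCoincident 3 n → S n z = 0) (hnd : IsNondegenerateTwoPoint S)
    (htr : IsTranslationInvariant S) (hsc : IsScaleCovariant Δ S) (hinv : IsInversionCovariant Δ S) :
    IsInversionPositive Δ S := by
  have hrot : IsRotationInvariant S := isRotationInvariant_of_scaleCovariantLimit hρ hlim hnorm hnd htr hsc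
  have hrp : IsReflectionPositiveAlong (0 : Fin 3) S :=
    stub_osReflectionPositive stub_latticeRP ρ S hρ hlim htr 0
  have hR : IsReflectionInvariantAlong (0 : Fin 3) S := fun n x => hrot n (axisReflection 0) x
  exact isInversionPositive_of_covariant_of_reflectionPositive 0 htr hsc hinv
    (isPermutationSymmetric_of_limit hlim hnorm) hR hrp

/-- **Item stmt-1982 implies item stmt-4671**: the inversion upgrade `InversionUpgradeNormalised`
gives `InversionPositiveLimit` (radial OS positivity of every normalised scale-covariant Ising₃
limit) — the "inequality half" of crux 4671 is implied by its "equality half".  Consequence for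
the registered skeleton `Cruxes/InversionPositiveLimit/Lines/birth.lean`: its STUB 2
(`stub_latticeRadialPositivity`) is redundant given STUB 1. [cite: LuscherMack1975, §2–§3] -/
theorem inversionPositiveLimit_of_inversionUpgradeNormalised
    (h1982 : Theses.HyperoctahedralRP.InversionUpgradeNormalised) :
    Theses.PositivityBegetsConformality.InversionPositiveLimit := by
  intro ρ Δ S hρ hlim hnorm hnd htr hsc
  have hrot : IsRotationInvariant S := isRotationInvariant_of_scaleCovariantLimit hρ hlim hnorm hnd htr hsc
  exact isInversionPositive_of_limit hρ hlim hnorm hnd htr hsc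
    (h1982 ρ Δ S hρ hlim hnorm hnd ⟨htr, hrot⟩ hsc)

/-- **Item stmt-4671 implies item stmt-1982** (the direction already in tree, assembled: item
stmt-4673 `moebiusOfInversionPositive_proof` turns inversion positivity of a limit into Möbius
covariance, whose inversion clause is the upgrade). [folklore] -/
theorem inversionUpgradeNormalised_of_inversionPositiveLimit
    (h4671 : Theses.PositivityBegetsConformality.InversionPositiveLimit) :
    Theses.HyperoctahedralRP.InversionUpgradeNormalised := by
  intro ρ Δ S hρ hlim hnorm hnd heuc hsc
  exact (moebiusOfInversionPositive_proof ρ Δ S hρ hlim hnorm hnd heuc.1 hsc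
    (h4671 ρ Δ S hρ hlim hnorm hnd heuc.1 hsc)).isInversionCovariant

/-- **`InversionPositiveLimit ⟺ InversionUpgradeNormalised` (crux stmt-4671 ⟺ crux stmt-1982).**
Radial OS positivity of the Ising₃ limit IS Polyakov's inversion upgrade — no more, no less.
[cite: LuscherMack1975, §2–§3] -/
theorem inversionPositiveLimit_iff_inversionUpgradeNormalised :
    Theses.PositivityBegetsConformality.InversionPositiveLimit ↔
      Theses.HyperoctahedralRP.InversionUpgradeNormalised :=
  ⟨inversionUpgradeNormalised_of_inversionPositiveLimit, inversionPositiveLimit_of_inversionUpgradeNormalised⟩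

/-- **The crux implies item stmt-4671**: a Möbius scaling limit of `criticalCorr 3` makes every
normalised scale-covariant limit inversion positive (crux ⇒ 1982 by `MoebiusLimitExists_iff_leaves`,
then `inversionPositiveLimit_of_inversionUpgradeNormalised`). [folklore] -/
theorem inversionPositiveLimit_of_MoebiusLimitExists (h : Theses.PerfectScreening.MoebiusLimitExists) :
    Theses.PositivityBegetsConformality.InversionPositiveLimit :=
  inversionPositiveLimit_of_inversionUpgradeNormalised (MoebiusLimitExists_iff_leaves.mp h).2

/-- **`MoebiusLimitExists ⟺ ExistsScaleCovariantLimit ∧ InversionPositiveLimit`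
(crux stmt-1344 ⟺ item stmt-1981 ∧ item stmt-4671)**: given existence, the crux is equally the
radial OS positivity of the limit.  Registered census anchor of line `Sketch`. [folklore] -/
theorem MoebiusLimitExists_iff_existence_and_inversionPositiveLimit :
    Summit.CriticalPhenomena.Ising3DConformalLimit.Theses.PerfectScreening.MoebiusLimitExists ↔
      Summit.CriticalPhenomena.Ising3DConformalLimit.Theses.HyperoctahedralRP.ExistsScaleCovariantLimit ∧
        Summit.CriticalPhenomena.Ising3DConformalLimit.Theses.PositivityBegetsConformality.InversionPositiveLimit :=
  ⟨fun h => ⟨(MoebiusLimitExists_iff_leaves.mp h).1, inversionPositiveLimit_of_MoebiusLimitExists h⟩,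
    fun h => MoebiusLimitExists_of_leaves h.1 (inversionUpgradeNormalised_of_inversionPositiveLimit h.2)⟩

end Summit.CriticalPhenomena.Ising3DConformalLimit.MoebiusLimitExistsInversionPositive

end
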